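import Literature.Probability.RandomPlanarGeometry.HexSAWStripSurfaceMonotone
import Literature.Probability.RandomPlanarGeometry.HexSAWBridgeLogDecay
import HarnessLib

/-!
# The strip threshold excess is at most the critical bridge generating function:
# `y_{T+1} − y* ≤ B_T(x_c, 1)`, hence `y_{T+1} − (1+√2) ≤ 5 (ln T)^{-1/3}`

Door «HEX-YT-RATE» of lane pub-sawmu (a-idea-1 gen 23; ed.2 = ed.1 3b068f0b with version-accurate citation wording only, no Lean change).  Beaton–Bousquet-Mélou–de Gier–Duminil-Copin–Guttmann
prove `y_c ≤ y* = 1+√2` (§4.5 of [BBdGDCG14]) from the arch cut (20) and the strip identity (16), through the display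

  «This gives, for `y < y_{T+1}`, `B_T(x_c,1) − β(y) B_{T+1}(x_c,y) ≤ α x_c B_T(x_c,1) B_{T+1}(x_c,y)`, or equivalently
   `0 ≤ 1/B_{T+1}(x_c,y) ≤ α x_c + (1/B_T(x_c,1)) · (y*−y)/(y(y*−1))`.»
  (wording of the EARLIER arXiv version, §4.5 — the held TeX `paper:arxiv-1109.0358`; arXiv v5 = CMP p. 15 prints the same
  chain SPECIALISED to `y = y_c`: (20) «holds in the domain of convergence of the series it involves, that is, for `y < y_{T+1}`,
  and thus in particular at `y_c`» and then «`0 ≤ 1/B_{T+1}(x_c,y_c) ≤ α x_c + (1/B_T(x_c,1)) · (y* − y_c)/(y_c(y* − 1))`»;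
  the general-`y` form is immediate from (20) + (18) exactly as print combines them at `y = y_c` — version note by lit-1 g15 / ref g42)

and then let `T → ∞` using only `B_T(x_c,1) → 0` (their Theorem 10).  The tree formalises exactly that qualitative
conclusion (`HexSAWSurfaceFugacity`: `stripByUnbounded_of_faces`, threshold `c·cos(3π/8)·B_T ≤ −β(y)/2`, and
`tendsto_stripYT_yStar : y_{T+1} → y*`).

This file extracts the QUANTITATIVE content of the same display, which the paper does not state:

* `stripBy_not_bddAbove_of_le` — the display read at finite `T` with the SHARP threshold: if
  `cos(3π/8)·x_c·B_T(x_c,1) + β(y) ≤ 0` then `L ↦ B_{T+1,L}(x_c,y)` is unbounded (so `y ≥ y_{T+1}`); the boundary case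
  `= 0` is included (the `E`-term of the finite-`L` identity is what is contradicted, via face Y3′).
* `sqrt_two_mul_cos_three_pi_div_eight` — `√2·cos(3π/8) = x_c`, so the threshold solved for `y` is
  `y = y*/(1 − x_c²·B_T(x_c,1))` (`x_c² = 1 − √2/2 = 0.2928…`):  `stripYT_succ_le_div`.
* `stripYT_succ_sub_yStar_le` — **`y_{T+1} − y* ≤ B_T(x_c,1)`** for every `T ≥ 1` (because `y*·x_c²/(1 − x_c²) = 1` and
  `B_T ≤ 1`), i.e. with the tree's lower half `y* ≤ y_{T+1}`:  `y_{T+1} ∈ [y*, y* + B_T(x_c,1)]`.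
* `stripYT_succ_sub_yStar_le_log` — with Glazman–Manolescu's explicit decay (tree `hexBridgeLogDecay : B_T(x_c) ≤ 5 (ln T)^{-1/3}`,
  `T ≥ 2`):  **`y_{T+1} − (1+√2) ≤ 5·(ln T)^{-1/3}`**, an explicit rate for BBdGDCG14 Corollary 8's «`y_T` decreases to `y_c`».

Here `y_T = stripYT T` is the LANE DEFINITION of `HexSAWSurfaceFugacity` (boundedness threshold in `y` of the critical bridge
class of `S_T`; = the printed `y_T` by Cor. 8, = Glazman–Manolescu 2020's `y_c(T, π/3)` by their Prop. 1.2 — readings, not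
formalised), `B_T(x_c,1) = stripBlim T`, `y* = yStar = 1 + √2`, `β = betaY`.

Imports: tree only (`HexSAWStripSurfaceMonotone`, `HexSAWBridgeLogDecay`) ⇒ CLASS S.  No `sorry`, no new axioms.

References: [BBdGDCG14] N. R. Beaton, M. Bousquet-Mélou, J. de Gier, H. Duminil-Copin, A. J. Guttmann, *The critical fugacity for
surface adsorption of self-avoiding walks on the honeycomb lattice is 1+√2*, Comm. Math. Phys. 326 (2014), arXiv:1109.0358v5,
§4.5 (p. 15), Theorem 10 (p. 14), Corollary 8 (p. 12).  [GM19] A. Glazman, I. Manolescu, *Self-avoiding walk on the hexagonal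
lattice: bridge decay*, Proposition 1.1 / eq. (3) (tree `HexSAWBridgeLogDecay`).  [DCS12] H. Duminil-Copin, S. Smirnov, Ann. Math. 175
(2012), §3 (strip identity, `B_T ≤ 1`).
-/

noncomputable section

open Finset Filter Topology

namespace Literature.Probability.RandomPlanarGeometry.SAW.HV

/-! ### The §4.5 display at finite `T`, sharp threshold -/

/-- **BBdGDCG14 §4.5 at finite width, sharp form.**  If `cos(3π/8)·x_c·B_T(x_c,1) + β(y) ≤ 0` (`T ≥ 1`, `y > 0`), then the
`y`-weighted bridge class of `S_{T+1}` is unbounded in `L` — the contrapositive of the printed «for `y < y_{T+1}`,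
`0 ≤ 1/B_{T+1}(x_c,y) ≤ α x_c + (1/B_T(x_c,1))·(y*−y)/(y(y*−1))`» (earlier arXiv version §4.5; v5 p. 15 prints it at `y = y_c`),
boundary case included.  Proof as printed: identity (16) at
`(T+1, y)` and at `(T, 1)` (tree `strip_identity_lim`), arch cut (20), `A_{T,L} ≤ A_T`; at finite `L` this reads
`B_T(x_c,1) ≤ (α x_c B_T + β(y))·B_{T+1,L}(y) + cos(π/4)·E_{T+1,L}(y) ≤ cos(π/4)·E_{T+1,L}(y)`, and if `B_{T+1,L}(y)` were bounded
then `E_{T+1,L}(y) → 0` (face Y3′), contradicting `B_T(x_c,1) > 0`.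
[cite: BeatonBousquetMelouDeGierDuminilCopinGuttmann2014, §4.5, eq. (20) (arXiv v5 p. 15: "This inequality holds in the domain of convergence of the series it involves, that is, for y < y_{T+1}, and thus in particular at y_c") and the display after it (v5 p. 15, printed at y = y_c: "0 ≤ 1/B_{T+1}(x_c,y_c) ≤ α x_c + (1/B_T(x_c,1)) · (y* − y_c)/(y_c(y* − 1))"; the general-y wording "This gives, for y < y_{T+1}, B_T(x_c,1) − β(y)B_{T+1}(x_c,y) ≤ αx_c B_T(x_c,1)B_{T+1}(x_c,y), or equivalently 0 ≤ 1/B_{T+1}(x_c,y) ≤ αx_c + (1/B_T(x_c,1))(y*−y)/(y(y*−1))" is the earlier arXiv version's §4.5 and is immediate from (20) + (18)), with §4.3 Proposition 9, eq. (18) (p. 14) and §4.4 Theorem 10 (p. 14)] -/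
theorem stripBy_not_bddAbove_of_le {T : ℕ} (hT : 1 ≤ T) {y : ℝ} (hy : 0 < y)
    (hle : Real.cos (3 * Real.pi / 8) * hexCriticalFugacity * stripBlim T + betaY y ≤ 0) :
    ¬ BddAbove (Set.range fun L : ℕ => stripGFy (T + 1) L (IsBetaDart (T + 1)) y) := by
  intro hbdd
  have hx : 0 < hexCriticalFugacity := hexCriticalFugacity_pos_lt_one.1
  have hα : 0 < Real.cos (3 * Real.pi / 8) := cos_three_pi_div_eight_pos
  have hε : 0 < Real.cos (Real.pi / 4) :=
    Real.cos_pos_of_mem_Ioo ⟨by linarith [Real.pi_pos], by linarith [Real.pi_pos]⟩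
  obtain ⟨K, hK⟩ := hbdd
  have hKL : ∀ L : ℕ, stripGFy (T + 1) L (IsBetaDart (T + 1)) y ≤ K := fun L => hK ⟨L, rfl⟩
  have hE := stripELimZeroY_holds (T + 1) y K (by omega) hy hKL
  -- the finite-`L` inequality `B_T ≤ cos(π/4) E_{T+1,L}(y)`
  have hlow : ∀ L : ℕ, stripBlim T ≤ Real.cos (Real.pi / 4) * stripGFy (T + 1) L (IsEpsDart L) y := by
    intro L
    have hid := stripIdentityY_holds (T + 1) L y (by omega) hy
    have hcut := stripArchCut_holds T L y hT hy
    have hAle := stripA_le_lim DuminilCopinSmirnov2012_lemma2_holds hT L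
    have hlim := strip_identity_lim hT
    have hB0 : 0 ≤ stripGFy (T + 1) L (IsBetaDart (T + 1)) y :=
      sum_nonneg fun _ _ => mul_nonneg (pow_nonneg hx.le _) (pow_nonneg hy.le _)
    have h4 : (Real.cos (3 * Real.pi / 8) * hexCriticalFugacity * stripBlim T + betaY y) *
        stripGFy (T + 1) L (IsBetaDart (T + 1)) y ≤ 0 := mul_nonpos_of_nonpos_of_nonneg hle hB0
    have h5 := mul_le_mul_of_nonneg_left hcut hα.le
    have h6 := mul_le_mul_of_nonneg_left hAle hα.le
    nlinarith [h4, h5, h6, hid, hlim]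
  have hpos : 0 < stripBlim T := stripBlim_pos hT
  have hev : ∀ᶠ L : ℕ in atTop, stripGFy (T + 1) L (IsEpsDart L) y < stripBlim T / Real.cos (Real.pi / 4) :=
    hE.eventually (gt_mem_nhds (by positivity))
  obtain ⟨L, hL⟩ := hev.exists
  have h1 := hlow L
  have h2 : Real.cos (Real.pi / 4) * stripGFy (T + 1) L (IsEpsDart L) y < stripBlim T :=
    calc Real.cos (Real.pi / 4) * stripGFy (T + 1) L (IsEpsDart L) y
        < Real.cos (Real.pi / 4) * (stripBlim T / Real.cos (Real.pi / 4)) := mul_lt_mul_of_pos_left hL hε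
      _ = stripBlim T := by field_simp
  linarith

/-- Hence **`y_{T+1} ≤ y`** for every such `y` (lane definition of `y_{T+1}`: the class is unbounded at `y`, and bounded below `y*`).
[cite: BeatonBousquetMelouDeGierDuminilCopinGuttmann2014, §4.5, eq. (20) and the display after it (arXiv v5 p. 15, printed at y = y_c; general y < y_{T+1}: earlier arXiv version §4.5, immediate from (20) + (18)) with Corollary 8 (p. 12: "The series (in y) … B_T(x_c;y) … have radius of convergence y_T")] -/
theorem stripYT_succ_le_of_le {T : ℕ} (hT : 1 ≤ T) {y : ℝ} (hy : 0 < y)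
    (hle : Real.cos (3 * Real.pi / 8) * hexCriticalFugacity * stripBlim T + betaY y ≤ 0) :
    stripYT (T + 1) ≤ y :=
  stripYT_le (stripBddSet_succ_nonempty T) hy.le (stripBy_not_bddAbove_of_le hT hy hle)

/-! ### The constants: `√2 cos(3π/8) = x_c`, `x_c² = 1 − √2/2` -/

/-- `√2·cos(3π/8) = x_c` (`cos(3π/8) = sin(π/8) = √(2−√2)/2`, `x_c = 1/√(2+√2)`, and `(2−√2)(2+√2) = 2`). [folklore]
[cite: DuminilCopinSmirnov2012, §1 ("x_c := 1/√(2+√2)") and §2 (the weights cos(3π/8))] -/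
theorem sqrt_two_mul_cos_three_pi_div_eight :
    Real.sqrt 2 * Real.cos (3 * Real.pi / 8) = hexCriticalFugacity := by
  have hc : Real.cos (3 * Real.pi / 8) = Real.sqrt (2 - Real.sqrt 2) / 2 := by
    rw [show (3 * Real.pi / 8 : ℝ) = Real.pi / 2 - Real.pi / 8 by ring, Real.cos_pi_div_two_sub,
      Real.sin_pi_div_eight]
  have hx : 0 < hexCriticalFugacity := hexCriticalFugacity_pos_lt_one.1
  have hs0 : 0 ≤ Real.sqrt 2 := Real.sqrt_nonneg 2
  have hs2 : Real.sqrt 2 ^ 2 = 2 := Real.sq_sqrt (by norm_num)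
  have hs_le : Real.sqrt 2 ≤ 2 := by nlinarith
  have ha2 : Real.sqrt (2 - Real.sqrt 2) ^ 2 = 2 - Real.sqrt 2 := Real.sq_sqrt (by linarith)
  have ha0 : 0 ≤ Real.sqrt (2 - Real.sqrt 2) := Real.sqrt_nonneg _
  have hxc := hexCriticalFugacity_sq
  -- both sides are nonnegative and have the same square times `(2 + √2)`
  have hl0 : 0 ≤ Real.sqrt 2 * Real.cos (3 * Real.pi / 8) := by rw [hc]; positivity
  have hsq : (Real.sqrt 2 * Real.cos (3 * Real.pi / 8)) ^ 2 = hexCriticalFugacity ^ 2 := by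
    have h1 : (Real.sqrt 2 * Real.cos (3 * Real.pi / 8)) ^ 2 * (2 + Real.sqrt 2) = 1 := by
      rw [hc, mul_pow, div_pow, ha2, hs2]
      nlinarith [hs2]
    have h2p : (0 : ℝ) < 2 + Real.sqrt 2 := by positivity
    exact mul_right_cancel₀ h2p.ne' (h1.trans hxc.symm)
  exact (pow_left_inj₀ hl0 hx.le two_ne_zero).1 hsq

/-- `cos(3π/8)·x_c = x_c²/√2` restated: `cos(3π/8) = x_c/√2`. [folklore] [cite: DuminilCopinSmirnov2012, §1–§2] -/
theorem cos_three_pi_div_eight_eq : Real.cos (3 * Real.pi / 8) = hexCriticalFugacity / Real.sqrt 2 := by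
  rw [← sqrt_two_mul_cos_three_pi_div_eight]
  have hs : (0 : ℝ) < Real.sqrt 2 := by positivity
  field_simp

/-- `x_c² = 1 − √2/2 (= 1/(2+√2) = 0.29289…)`. [cite: DuminilCopinSmirnov2012, §1 ("x_c := 1/√(2+√2)")] -/
theorem hexCriticalFugacity_sq_eq_one_sub : hexCriticalFugacity ^ 2 = 1 - Real.sqrt 2 / 2 := by
  have hxc := hexCriticalFugacity_sq
  have hs2 : Real.sqrt 2 ^ 2 = 2 := Real.sq_sqrt (by norm_num)
  have h2p : (0 : ℝ) < 2 + Real.sqrt 2 := by positivity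
  have h1 : (1 - Real.sqrt 2 / 2) * (2 + Real.sqrt 2) = 1 := by nlinarith [hs2]
  exact mul_right_cancel₀ h2p.ne' (hxc.trans h1.symm)

/-- `0 < 1 − x_c²·B_T(x_c,1)` (`x_c² < 1`, `B_T ≤ 1`), so the solved threshold below is a genuine positive number.
[cite: DuminilCopinSmirnov2012, §3, eq. (4) (B_T ≤ 1)] -/
theorem one_sub_sq_mul_stripBlim_pos {T : ℕ} (hT : 1 ≤ T) : 0 < 1 - hexCriticalFugacity ^ 2 * stripBlim T := by
  have hB1 := stripBlim_le_one hT
  have hB0 := stripBlim_nonneg hT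
  have hq := hexCriticalFugacity_sq_eq_one_sub
  have hs1 : 1 < Real.sqrt 2 := by
    rw [show (1 : ℝ) = Real.sqrt 1 by simp]
    exact Real.sqrt_lt_sqrt zero_le_one (by norm_num)
  nlinarith

/-! ### The solved threshold and the excess bound -/

/-- **The §4.5 display solved for `y`:  `y_{T+1} ≤ y*/(1 − x_c²·B_T(x_c,1))`** (`T ≥ 1`).  At `y = y*/(1 − x_c² B_T)` one has
`cos(3π/8)·x_c·B_T + β(y) = 0` exactly (`√2 cos(3π/8) = x_c`, `β(y) = (y*−y)/(√2 y)`).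
[cite: BeatonBousquetMelouDeGierDuminilCopinGuttmann2014, §4.5, eq. (20) and the display after it (arXiv v5 p. 15, printed at y = y_c: "0 ≤ 1/B_{T+1}(x_c,y_c) ≤ α x_c + (1/B_T(x_c,1)) · (y* − y_c)/(y_c(y* − 1))"; for general y < y_{T+1} in the earlier arXiv version §4.5), solved for y — lane step; with Theorem 10 (p. 14)] -/
theorem stripYT_succ_le_div {T : ℕ} (hT : 1 ≤ T) :
    stripYT (T + 1) ≤ yStar / (1 - hexCriticalFugacity ^ 2 * stripBlim T) := by
  have hD := one_sub_sq_mul_stripBlim_pos hT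
  have hyS : 0 < yStar := yStar_pos
  have hs : (0 : ℝ) < Real.sqrt 2 := by positivity
  have hy : 0 < yStar / (1 - hexCriticalFugacity ^ 2 * stripBlim T) := div_pos hyS hD
  refine stripYT_succ_le_of_le hT hy (le_of_eq ?_)
  rw [cos_three_pi_div_eight_eq]
  unfold betaY yStar
  have h1 : (1 : ℝ) + Real.sqrt 2 ≠ 0 := by positivity
  field_simp
  ring

/-- **`y_{T+1} − y* ≤ B_T(x_c,1)`** for every `T ≥ 1`: the strip threshold excess over `y* = 1+√2` is at most the critical bridge
generating function of the strip one narrower (`y*·x_c²·B_T/(1 − x_c² B_T) ≤ B_T` since `y* x_c² = √2/2 = 1 − x_c²` and `B_T ≤ 1`).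
Not stated in [BBdGDCG14] (whose §4.5 takes `T → ∞` at once); it is the quantitative content of their display.
[cite: BeatonBousquetMelouDeGierDuminilCopinGuttmann2014, §4.5, eq. (20) and the display after it (arXiv v5 p. 15, printed at y = y_c) with Theorem 10 (p. 14), Theorem 2 (p. 3: y_c = 1+√2 = y*) and Corollary 8 (p. 12: "y_T decreases to the critical fugacity y_c"); finite-T excess bound — lane derivation, not in print] -/
theorem stripYT_succ_sub_yStar_le {T : ℕ} (hT : 1 ≤ T) : stripYT (T + 1) - yStar ≤ stripBlim T := by
  have h := stripYT_succ_le_div hT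
  have hD := one_sub_sq_mul_stripBlim_pos hT
  have hB1 := stripBlim_le_one hT
  have hB0 := stripBlim_nonneg hT
  have hq := hexCriticalFugacity_sq_eq_one_sub
  have hs2 : Real.sqrt 2 ^ 2 = 2 := Real.sq_sqrt (by norm_num)
  have hs0 : (0 : ℝ) ≤ Real.sqrt 2 := Real.sqrt_nonneg 2
  have hq0 : 0 ≤ 1 - Real.sqrt 2 / 2 := by rw [← hq]; positivity
  have key : yStar / (1 - hexCriticalFugacity ^ 2 * stripBlim T) ≤ yStar + stripBlim T := by
    rw [div_le_iff₀ hD, hq]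
    unfold yStar
    nlinarith [mul_nonneg (mul_nonneg hq0 hB0) (sub_nonneg.2 hB1)]
  linarith

/-- Two-sided: **`y_{T+1} ∈ [y*, y* + B_T(x_c,1)]`** (`T ≥ 1`; lower half = tree `yStar_le_stripYT`, §4.2).
[cite: BeatonBousquetMelouDeGierDuminilCopinGuttmann2014, §4.2 eq. (17) (arXiv v5 p. 14) and §4.5, eq. (20) and the display after it (p. 15, printed at y = y_c); finite-T form — lane derivation] -/
theorem stripYT_succ_mem_Icc_yStar {T : ℕ} (hT : 1 ≤ T) :
    stripYT (T + 1) ∈ Set.Icc yStar (yStar + stripBlim T) :=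
  ⟨yStar_le_stripYT (by omega), by linarith [stripYT_succ_sub_yStar_le hT]⟩

/-- The same in the strip's own width: **`y_T − y* ≤ B_{T−1}(x_c,1)`** for `T ≥ 2`.
[cite: BeatonBousquetMelouDeGierDuminilCopinGuttmann2014, §4.5, eq. (20) and the display after it (arXiv v5 p. 15, printed at y = y_c); finite-T excess bound — lane derivation, not in print] -/
theorem stripYT_sub_yStar_le {T : ℕ} (hT : 2 ≤ T) : stripYT T - yStar ≤ stripBlim (T - 1) := by
  obtain ⟨T, rfl⟩ : ∃ T', T = T' + 1 := ⟨T - 1, by omega⟩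
  simpa using stripYT_succ_sub_yStar_le (T := T) (by omega)

/-! ### The explicit rate -/

/-- **Explicit rate of `y_T → y*`:  `y_{T+1} − (1+√2) ≤ 5·(ln T)^{-1/3}`** for every `T ≥ 2`, from `y_{T+1} − y* ≤ B_T(x_c,1)` and
Glazman–Manolescu's decay with the tree's explicit constant (`hexBridgeLogDecay : B_T(x_c) ≤ 5 (ln T)^{-1/3}`, `T ≥ 2`).
[cite: BeatonBousquetMelouDeGierDuminilCopinGuttmann2014, Corollary 8 (arXiv v5 p. 12: "y_T decreases to the critical fugacity y_c"), Theorem 2 (p. 3) and §4.5 (p. 15); explicit (very weak) rate — lane composite of the finite-T excess bound with GM19, not in print]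
[cite: GlazmanManolescu2019, Proposition 1.1 and eq. (3)] -/
theorem stripYT_succ_sub_yStar_le_log {T : ℕ} (hT : 2 ≤ T) :
    stripYT (T + 1) - yStar ≤ 5 * (Real.log T) ^ (-(1 : ℝ) / 3) :=
  (stripYT_succ_sub_yStar_le (by omega)).trans (hexBridgeLogDecay T hT)

/-- Unfolded: `y_{T+1} ≤ 1 + √2 + 5 (ln T)^{-1/3}` (`T ≥ 2`).
[cite: BeatonBousquetMelouDeGierDuminilCopinGuttmann2014, Corollary 8 (arXiv v5 p. 12), Theorem 2 (p. 3) and §4.5 (p. 15); explicit rate — lane composite, not in print] [cite: GlazmanManolescu2019, Proposition 1.1 and eq. (3)] -/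
theorem stripYT_succ_le_log {T : ℕ} (hT : 2 ≤ T) :
    stripYT (T + 1) ≤ 1 + Real.sqrt 2 + 5 * (Real.log T) ^ (-(1 : ℝ) / 3) := by
  have h := stripYT_succ_sub_yStar_le_log hT
  unfold yStar at h
  linarith

end Literature.Probability.RandomPlanarGeometry.SAW.HV
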